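import Summits.FinalStateConjecture.FinalStateConjecture.Theorems.EIHFluxBalanceInertialRecessionNoHoles
import Literature.Geometry.Lorentzian.KerrConvergenceProofs

/-!
# Route EIHFluxBalance — `InertialRecession`: chart calculus for re-charting a lab chart

Helper file for the crux `stmt-FinalStateConjecture-10166`
(`Summit.FinalStateConjecture.FinalStateConjecture.Theses.EIHFluxBalance.InertialRecession`).

Every proof of `InertialRecession` ends by RE-CHARTING the given lab chart `Φ : U → M` into the
charts of a `FinalStateDecomposition`: hole charts on (boosted, translated) Kerr exteriors and a
flat chart on a sub-domain of `U`, all of the form `Φ ∘ (explicit map)`. This file collects the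
chart calculus this needs, over an ARBITRARY reference background `B` (the crux's background is a
literal `⟨U, b, t, r⟩`, not one of the named backgrounds of `KerrConvergence.lean`):

* `poincareInv_one`, `boostedKerrBilin_one`, `kerr_bilin_eq_of_spatial_eq`,
  `spatial_sub_ofTimeSpace` — the trivial boost with a translation; stationarity of the
  Kerr–Schild form (so a resting modulated hole is a FIXED translated Kerr–Schild field);
* `exists_smooth_timeClamp`, `timeClampMap_props` — a smooth clamp `θ > τ₀`, `θ = id` after
  `τ₀ + 1`, and the induced self-map of `E4` (to extend a chart given on `{x⁰ > τ₀}` to a smooth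
  map on a whole reference domain, agreeing with it on the late region);
* `deviation_backgroundOn_comp_inclusion'`, `deviationExtend_backgroundOn_eventuallyEq'`,
  `contDiffAt_deviationExtend_of_bilin` — general-background forms of the restriction lemmas of
  `KerrConvergenceProofs` (`(Φ|_W)^* g − η = (Φ^* g − g₀) + (g₀ − η)`, smoothness of the
  extended deviation where `g₀` is smooth);
* `tendsto_deviationCk_backgroundOn_of_kerr_sub` — the radiation zone of a chart converging to a
  TRANSLATED Kerr–Schild field converges to `η` on `{r(x − c₀) > ρ(x⁰)}`, `ρ → ∞`
  (`Kerr.norm_iteratedFDeriv_ksPert_le`, translation invariance of `iteratedFDeriv`).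

Used by `EIHFluxBalanceInertialRecessionOneHole.lean` (one hole at rest in the lab frame).
-/

noncomputable section

open scoped Manifold ContDiff Topology BigOperators ENNReal
open Filter Set TopologicalSpace Literature.Geometry.Lorentzian

namespace Summit.FinalStateConjecture.FinalStateConjecture.Theorems

/-! ### The trivial boost with a translation -/

/-- `poincareInv 1 c x = x − c` (O'Neill 1983, Ch. 9, p. 236). [folklore] -/
theorem poincareInv_one (c x : E4) : poincareInv 1 c x = x - c := by
  rw [poincareInv]
  rfl

/-- For the trivial boost the boosted Kerr–Schild form is the translated one,
`boostedKerrBilin 1 c M a x = g_{M,a}(x − c)` (Kerr–Schild 1965, Lorentz/translation covariance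
of the ansatz). [folklore] -/
theorem boostedKerrBilin_one (c : E4) (M a : ℝ) (x : E4) :
    boostedKerrBilin 1 c M a x = Kerr.bilin M a (x - c) := by
  ext v w
  rw [boostedKerrBilin_apply, poincareInv_one]
  rfl

/-- The Kerr–Schild form is stationary: it depends on the point only through its spatial part
(Kerr–Schild 1965, §2). [folklore] -/
theorem kerr_bilin_eq_of_spatial_eq (M a : ℝ) {x y : E4} (h : E4.spatial x = E4.spatial y) :
    Kerr.bilin M a x = Kerr.bilin M a y :=
  sub_left_injective (Kerr.ksPert_eq_of_spatial_eq M a h)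

/-- Spatial part of `x − (t, ξ₀)`: it does not depend on `t`. [folklore] -/
theorem spatial_sub_ofTimeSpace (x : E4) (t : ℝ) (ξ₀ : E3) :
    E4.spatial (x - E4.ofTimeSpace t ξ₀) = E4.spatial (x - E4.ofTimeSpace 0 ξ₀) := by
  rw [map_sub, map_sub, E4.spatial_ofTimeSpace, E4.spatial_ofTimeSpace]

/-! ### A smooth time clamp -/

/-- **A smooth clamp of the time axis above `τ₀`**: there is a smooth `θ : ℝ → ℝ` with `θ > τ₀`
everywhere and `θ(s) = s` for `s ≥ τ₀ + 1` (take
`θ(s) = τ₀ + 1 + (s − τ₀ − 1) · smoothTransition(s − τ₀)`). Used to extend a chart given on a late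
region `{x⁰ > τ₀}` to a smooth map on all times which agrees with it after `τ₀ + 1`. [folklore] -/
theorem exists_smooth_timeClamp (τ₀ : ℝ) :
    ∃ θ : ℝ → ℝ, ContDiff ℝ ∞ θ ∧ (∀ s, τ₀ < θ s) ∧ ∀ s, τ₀ + 1 ≤ s → θ s = s := by
  refine ⟨fun s ↦ τ₀ + 1 + (s - (τ₀ + 1)) * Real.smoothTransition (s - τ₀), ?_, ?_, ?_⟩
  · exact contDiff_const.add ((contDiff_id.sub contDiff_const).mul
      (Real.smoothTransition.contDiff.comp (contDiff_id.sub contDiff_const)))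
  · intro s
    dsimp only
    by_cases hs : s ≤ τ₀
    · rw [Real.smoothTransition.zero_of_nonpos (by linarith), mul_zero, add_zero]
      linarith
    · by_cases hc : 0 ≤ s - (τ₀ + 1)
      · have := mul_nonneg hc (Real.smoothTransition.nonneg (s - τ₀))
        linarith
      · have h1 : (s - (τ₀ + 1)) * 1 ≤ (s - (τ₀ + 1)) * Real.smoothTransition (s - τ₀) :=
          mul_le_mul_of_nonpos_left (Real.smoothTransition.le_one _) (not_le.mp hc).le
        linarith [not_le.mp hs]
  · intro s hs
    dsimp only
    rw [Real.smoothTransition.one_of_one_le (by linarith), mul_one]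
    ring

/-! ### Chart calculus over a reference background -/

section ChartCalculus

variable (𝓢 : Spacetime 4)

/-- Unfolding of `Spacetime.deviation` as a difference of bilinear-form fields. [folklore] -/
theorem deviation_eq_pullbackBilin_sub (B : ModelBackground) (Ψ : B.domain → 𝓢.carrier)
    (x : B.domain) :
    𝓢.deviation B Ψ x =
      (show E4 →L[ℝ] E4 →L[ℝ] ℝ from
        pullbackBilin (I := 𝓡 4) (I' := 𝓘(ℝ, E4)) Ψ 𝓢.metric.val x) - B.bilin x.1 :=
  rfl

/-- In a chart `Φ` on the background `B` restricted to an open `W ≤ B.domain`, the deviation from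
the *Minkowski* background on `W` is the deviation from `B` plus `g₀ − η`:
`(Φ|_W)^* g − η = (Φ^* g − g₀) + (g₀ − η)` (chain rule along the inclusion, whose differential is
the identity; DHRT arXiv:2104.08222, §1 for the deviation). General-background form of
`Spacetime.deviation_backgroundOn_comp_inclusion`. [folklore] -/
theorem deviation_backgroundOn_comp_inclusion' (B : ModelBackground) {W : Opens E4}
    (h : (Minkowski.backgroundOn W).domain ≤ B.domain)
    {Φ : B.domain → 𝓢.carrier} (hΦ : ContMDiff 𝓘(ℝ, E4) (𝓡 4) ∞ Φ)
    (x : (Minkowski.backgroundOn W).domain) :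
    𝓢.deviation (Minkowski.backgroundOn W) (Φ ∘ Opens.inclusion h) x =
      𝓢.deviation B Φ (Opens.inclusion h x) + (B.bilin x.1 - Minkowski.bilin) := by
  have hΦd : MDifferentiable 𝓘(ℝ, E4) (𝓡 4) Φ := hΦ.mdifferentiable (by simp)
  have hid : MDifferentiable 𝓘(ℝ, E4) 𝓘(ℝ, E4) (Opens.inclusion h) :=
    (contMDiff_inclusion (n := ∞) h).mdifferentiable (by simp)
  have hcomp := congrFun (pullbackBilin_comp (I' := 𝓘(ℝ, E4)) (I := 𝓘(ℝ, E4)) (I'' := 𝓡 4)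
    hΦd hid 𝓢.metric.val) x
  have e1 : ∀ v w : E4,
      pullbackBilin (I := 𝓡 4) (I' := 𝓘(ℝ, E4)) (Φ ∘ Opens.inclusion h) 𝓢.metric.val x v w =
        pullbackBilin (I := 𝓡 4) (I' := 𝓘(ℝ, E4)) Φ 𝓢.metric.val (Opens.inclusion h x) v w := by
    intro v w
    rw [hcomp, pullbackBilin_apply (f := Opens.inclusion h), OpensChart.mfderiv_inclusion_apply,
      OpensChart.mfderiv_inclusion_apply]
  have hb1 : (Minkowski.backgroundOn W).bilin x.1 = Minkowski.bilin := rfl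
  have hb2 : B.bilin (Opens.inclusion h x).1 = B.bilin x.1 := rfl
  rw [deviation_eq_pullbackBilin_sub, deviation_eq_pullbackBilin_sub, hb1, hb2]
  refine ContinuousLinearMap.ext fun v ↦ ContinuousLinearMap.ext fun w ↦ ?_
  rw [sub_apply, sub_apply, add_apply, add_apply, sub_apply, sub_apply, sub_apply, sub_apply,
    sub_add_sub_cancel]
  exact congrArg (fun r : ℝ ↦ r - Minkowski.bilin v w) (e1 v w)

/-- Extended-by-zero form of `deviation_backgroundOn_comp_inclusion'`, as an eventual equality
near a point of `W` (DHRT arXiv:2104.08222, §1). [folklore] -/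
theorem deviationExtend_backgroundOn_eventuallyEq' (B : ModelBackground) {W : Opens E4}
    (h : (Minkowski.backgroundOn W).domain ≤ B.domain)
    {Φ : B.domain → 𝓢.carrier} (hΦ : ContMDiff 𝓘(ℝ, E4) (𝓡 4) ∞ Φ) {z : E4} (hz : z ∈ W) :
    𝓢.deviationExtend (Minkowski.backgroundOn W) (Φ ∘ Opens.inclusion h) =ᶠ[𝓝 z]
      fun y ↦ 𝓢.deviationExtend B Φ y + (B.bilin y - Minkowski.bilin) := by
  filter_upwards [W.2.mem_nhds hz] with y hy
  have hy' : y ∈ (Minkowski.backgroundOn W).domain := hy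
  have e1 := 𝓢.deviationExtend_coe (Minkowski.backgroundOn W) (Φ ∘ Opens.inclusion h) ⟨y, hy'⟩
  have e2 := 𝓢.deviationExtend_coe B Φ (Opens.inclusion h ⟨y, hy'⟩)
  exact e1.trans ((deviation_backgroundOn_comp_inclusion' 𝓢 B h hΦ ⟨y, hy'⟩).trans
    (congrArg (· + (B.bilin y - Minkowski.bilin)) e2.symm))

/-- **The extended deviation `Φ^* g − g₀` of a smooth chart map is `C^∞` at every point of the
reference domain at which the reference field `g₀` is**: the pullback `Φ^* g` is a smooth section
of the bundle of bilinear forms (`contMDiff_pullbackBilin_holds`, O'Neill 1983, Ch. 3,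
Lemma 3.35 ff.), i.e. its components are smooth over the open subset `U ⊆ E4`
(`OpensChart.contMDiffAt_bilinSection_iff`). General-background form of
`Spacetime.contDiffAt_deviationExtend_kerr`. [folklore] -/
theorem contDiffAt_deviationExtend_of_bilin (B : ModelBackground) {Φ : B.domain → 𝓢.carrier}
    (hΦ : ContMDiff 𝓘(ℝ, E4) (𝓡 4) ∞ Φ) (x : B.domain) (hb : ContDiffAt ℝ ∞ B.bilin x) :
    ContDiffAt ℝ ∞ (𝓢.deviationExtend B Φ) x := by
  have hsec := PseudoRiemannianMetric.contMDiff_pullbackBilin_holds (I := 𝓡 4) (M := 𝓢.carrier)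
    (I' := 𝓘(ℝ, E4)) (N := B.domain) (n := ∞) Φ hΦ 𝓢.metric.toPseudoRiemannianMetric
  have hGs : ContDiffAt ℝ ∞ (fun z ↦ 𝓢.deviationExtend B Φ z + B.bilin z) x := by
    refine (OpensChart.contMDiffAt_bilinSection_iff x
      (fun y ↦ pullbackBilin (I := 𝓡 4) (I' := 𝓘(ℝ, E4)) Φ 𝓢.metric.val y)
      (fun z ↦ 𝓢.deviationExtend B Φ z + B.bilin z) fun y ↦ ?_).1 (hsec x)
    have e : ∀ v w : E4, (𝓢.deviationExtend B Φ y + B.bilin y) v w =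
        (show E4 →L[ℝ] E4 →L[ℝ] ℝ from
          pullbackBilin (I := 𝓡 4) (I' := 𝓘(ℝ, E4)) Φ 𝓢.metric.val y) v w := by
      intro v w
      rw [add_apply, add_apply, 𝓢.deviationExtend_coe, deviation_eq_pullbackBilin_sub, sub_apply,
        sub_apply, sub_add_cancel]
    show (show E4 →L[ℝ] E4 →L[ℝ] ℝ from
        pullbackBilin (I := 𝓡 4) (I' := 𝓘(ℝ, E4)) Φ 𝓢.metric.val y) =
      𝓢.deviationExtend B Φ y + B.bilin y
    exact ContinuousLinearMap.ext fun v ↦ ContinuousLinearMap.ext fun w ↦ (e v w).symm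
  have hfun : 𝓢.deviationExtend B Φ =
      fun z ↦ (𝓢.deviationExtend B Φ z + B.bilin z) - B.bilin z := by
    funext z
    exact (add_sub_cancel_right (𝓢.deviationExtend B Φ z) (B.bilin z)).symm
  rw [hfun]
  exact hGs.sub hb

-- the algebraic and the operator-norm instance paths on `E4 →L[ℝ] E4 →L[ℝ] ℝ` unify slowly
set_option synthInstance.maxHeartbeats 200000 in
/-- **The radiation zone of a resting hole converges to Minkowski space.** If `Φ` is a smooth
chart on a background `B` with lab time `x⁰` and reference field the translated Kerr–Schild form
`g_{M,a}(· − c₀)`, whose `Cᵏ` deviation on the lab slabs tends to `0`, and `W ≤ B.domain` is an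
open set whose slice at time `τ` lies in `{r(x − c₀) > ρ(τ)}` with `ρ(τ) → ∞`, then the `Cᵏ`
deviation of `Φ|_W` from `η` on the slabs of `W` tends to `0`:
`Φ^* g − η = (Φ^* g − g_{M,a}(· − c₀)) + (g_{M,a}(· − c₀) − η)` and
`‖D^m (g_{M,a} − η)‖ ≤ C / r ≤ C / ρ(τ)` there (DHRT arXiv:2104.08222, §1, with the asymptotic
flatness of the Kerr–Schild form, `Kerr.norm_iteratedFDeriv_ksPert_le`). Translated form of
`Spacetime.tendsto_deviationCk_backgroundOn`. [folklore] -/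
theorem tendsto_deviationCk_backgroundOn_of_kerr_sub {M a : ℝ} {c₀ : E4} {k : ℕ}
    (B : ModelBackground) (hBb : ∀ x, B.bilin x = Kerr.bilin M a (x - c₀))
    (hBt : ∀ x, B.time x = x 0) {W : Opens E4}
    {Φ : B.domain → 𝓢.carrier} (hΦ : ContMDiff 𝓘(ℝ, E4) (𝓡 4) ∞ Φ)
    (ht : Tendsto (fun τ ↦ 𝓢.deviationCk B Φ k τ) atTop (𝓝 0))
    {ρ : ℝ → ℝ} (hρ : Tendsto ρ atTop atTop)
    (hW : ∀ z ∈ W, ρ (z 0) < Kerr.radius a (z - c₀))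
    (h : (Minkowski.backgroundOn W).domain ≤ B.domain) :
    Tendsto (fun τ ↦ 𝓢.deviationCk (Minkowski.backgroundOn W) (Φ ∘ Opens.inclusion h) k τ)
      atTop (𝓝 0) := by
  have hBfun : B.bilin = fun x ↦ Kerr.bilin M a (x - c₀) := funext hBb
  have hdec := fun m ↦ Kerr.norm_iteratedFDeriv_ksPert_le M a m
  choose C R hR hCR using hdec
  set Cmax : ℝ := ∑ m ∈ Finset.range (k + 1), |C m| with hCmax
  set Rmax : ℝ := ∑ m ∈ Finset.range (k + 1), R m with hRmax
  have hCm : ∀ m ≤ k, |C m| ≤ Cmax := fun m hm ↦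
    Finset.single_le_sum (f := fun m ↦ |C m|) (fun _ _ ↦ abs_nonneg _)
      (Finset.mem_range.mpr (Nat.lt_succ_of_le hm))
  have hRm : ∀ m ≤ k, R m ≤ Rmax := fun m hm ↦
    Finset.single_le_sum (f := R) (fun m _ ↦ (hR m).le)
      (Finset.mem_range.mpr (Nat.lt_succ_of_le hm))
  have hRmax0 : 0 < Rmax := (hR 0).trans_le (hRm 0 (Nat.zero_le k))
  have hCmax0 : 0 ≤ Cmax := Finset.sum_nonneg fun _ _ ↦ abs_nonneg _
  -- translated Kerr–Schild perturbation and its derivatives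
  have hks : ∀ (m : ℕ) (x : E4),
      iteratedFDeriv ℝ m (fun y ↦ Kerr.bilin M a (y - c₀) - Minkowski.bilin) x =
        iteratedFDeriv ℝ m (fun y ↦ Kerr.bilin M a y - Minkowski.bilin) (x - c₀) :=
    fun m x ↦ iteratedFDeriv_comp_sub (f := fun y ↦ Kerr.bilin M a y - Minkowski.bilin) m c₀ x
  have hbound : ∀ τ, Rmax ≤ ρ τ →
      𝓢.deviationCk (Minkowski.backgroundOn W) (Φ ∘ Opens.inclusion h) k τ ≤
        𝓢.deviationCk B Φ k τ + ENNReal.ofReal (Cmax / ρ τ) := by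
    intro τ hτ
    refine iSup₂_le fun m hm ↦ iSup₂_le fun z hz ↦ ?_
    obtain ⟨x, hx, rfl⟩ := hz
    have hxW : (x : E4) ∈ W := x.2
    have hx0 : (x : E4) 0 = τ := hx
    have hrad : ρ τ < Kerr.radius a (x - c₀) := hx0 ▸ hW x hxW
    have hρpos : 0 < ρ τ := hRmax0.trans_le hτ
    have hr0 : 0 < Kerr.radius a (x - c₀) := hρpos.trans hrad
    have hsub : ContDiffAt ℝ ∞ (fun y : E4 ↦ y - c₀) x := contDiffAt_id.sub contDiffAt_const
    have hb' : ContDiffAt ℝ ∞ (fun y : E4 ↦ Kerr.bilin M a (y - c₀)) x :=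
      ContDiffAt.comp (g := Kerr.bilin M a) (f := fun y : E4 ↦ y - c₀) (x : E4)
        (Kerr.contDiffAt_bilin M a hr0) hsub
    have hb : ContDiffAt ℝ ∞ B.bilin (Opens.inclusion h x) := by
      rw [hBfun]
      exact hb'
    have h1 : ContDiffAt ℝ m (𝓢.deviationExtend B Φ) x :=
      (contDiffAt_deviationExtend_of_bilin 𝓢 B hΦ (Opens.inclusion h x) hb).of_le
        (by exact_mod_cast le_top)
    have h2 : ContDiffAt ℝ m (fun y ↦ Kerr.bilin M a (y - c₀) - Minkowski.bilin) x :=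
      (hb'.sub contDiffAt_const).of_le (by exact_mod_cast le_top)
    have hev := deviationExtend_backgroundOn_eventuallyEq' 𝓢 B h hΦ hxW
    rw [hBfun] at hev
    rw [(hev.iteratedFDeriv ℝ m).eq_of_nhds]
    change ‖iteratedFDeriv ℝ m (𝓢.deviationExtend B Φ +
      fun y ↦ Kerr.bilin M a (y - c₀) - Minkowski.bilin) x‖ₑ ≤ _
    have hmem : (x : E4) ∈ Subtype.val '' B.timeSlab τ :=
      ⟨Opens.inclusion h x, (hBt x).trans hx0, rfl⟩
    refine (enorm_iteratedFDeriv_add_le h1 h2).trans (add_le_add ?_ ?_)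
    · exact enorm_iteratedFDeriv_le_supCkENorm hm hmem _
    · refine enorm_le_ofReal_of_norm_le ?_
      have hRle : R m ≤ Kerr.radius a (x - c₀) := ((hRm m hm).trans hτ).trans hrad.le
      calc (‖iteratedFDeriv ℝ m (fun y ↦ Kerr.bilin M a (y - c₀) - Minkowski.bilin) x‖ : ℝ)
          = ‖iteratedFDeriv ℝ m (fun y ↦ Kerr.bilin M a y - Minkowski.bilin) (x - c₀)‖ := by
            rw [hks]
        _ ≤ C m / Kerr.radius a (x - c₀) := hCR m (x - c₀) hRle
        _ ≤ Cmax / Kerr.radius a (x - c₀) :=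
          div_le_div_of_nonneg_right ((le_abs_self _).trans (hCm m hm)) hr0.le
        _ ≤ Cmax / ρ τ := div_le_div_of_nonneg_left hCmax0 hρpos hrad.le
  have hlim : Tendsto (fun τ ↦ 𝓢.deviationCk B Φ k τ + ENNReal.ofReal (Cmax / ρ τ)) atTop
      (𝓝 0) := by
    have h2 : Tendsto (fun τ ↦ Cmax / ρ τ) atTop (𝓝 0) := tendsto_const_nhds.div_atTop hρ
    simpa using ht.add (ENNReal.tendsto_ofReal h2)
  refine tendsto_of_tendsto_of_tendsto_of_le_of_le' tendsto_const_nhds hlim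
    (Eventually.of_forall fun _ ↦ zero_le) ?_
  filter_upwards [hρ.eventually_ge_atTop Rmax] with τ hτ
  exact hbound τ hτ

end ChartCalculus

/-! ### The time-clamp self-map of `E4` -/

/-- Properties of the clamp self-map `Θ(y) = y + (θ(y⁰) − y⁰) e₀` of `E4` built from a time clamp
`θ`: it is smooth, replaces the time coordinate by `θ(y⁰)`, keeps the spatial part, and is the
identity where `θ` is. [folklore] -/
theorem timeClampMap_props {θ : ℝ → ℝ} (hθ : ContDiff ℝ ∞ θ) :
    ContDiff ℝ ∞ (fun y : E4 ↦ y + (θ (y 0) - y 0) • E4.basisVector 0) ∧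
      (∀ y : E4, (y + (θ (y 0) - y 0) • E4.basisVector 0) 0 = θ (y 0)) ∧
      (∀ y : E4, E4.spatial (y + (θ (y 0) - y 0) • E4.basisVector 0) = E4.spatial y) ∧
      ∀ y : E4, θ (y 0) = y 0 → y + (θ (y 0) - y 0) • E4.basisVector 0 = y := by
  have h0 : ContDiff ℝ ∞ fun y : E4 ↦ y 0 :=
    (EuclideanSpace.proj (0 : Fin 4) : E4 →L[ℝ] ℝ).contDiff
  refine ⟨contDiff_id.add (((hθ.comp h0).sub h0).smul contDiff_const), fun y ↦ ?_, fun y ↦ ?_,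
    fun y hy ↦ ?_⟩
  · simp
  · ext i
    simp [E4.spatial_apply, Fin.succ_ne_zero]
  · rw [hy, sub_self, zero_smul, add_zero]

end Summit.FinalStateConjecture.FinalStateConjecture.Theorems

end
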